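import Summits.ABC.StewartYu.PadicMultiquadratic
import Literature.NumberTheory.Transcendental.PadicLiouvilleInequality
import HarnessLib

/-!
# Cell abc-stewartyu, WP-A3 (ii): the `p`-adic Liouville inequality in `ℚ(√α₁, …, √αₖ) ⊂ ℚ_p`

`Summits/ABC/StewartYu/PadicMultiquadraticLiouville.lean` — cell `abc-stewartyu` (HOME
`run/shared/lean/pub/abc-stewartyu/`, seat p3, work package WP-A3 of `HOME/p2/PADIC-CORE.md`;
theorems only, no definition, no named fact), sequel to `PadicMultiquadratic.lean`.

The `p`-adic counterpart of the tree's `CW77.abs_ev_ge` (Cijsouw–Waldschmidt 1977, Lemma 10 over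
`ℚ`, file `CijsouwWaldschmidt1977Liouville.lean`): for rationals `αⱼ` with `𝔽₂`-independent square
classes and `p`-adic integers `sⱼ ∈ ℚ_p` with `sⱼ² = αⱼ`, a non-zero coefficient vector `c` with
`D c_S ∈ ℤ` and `∑ |c_S| ≤ M` has

  `‖∑_S c_S ∏_{j∈S} sⱼ‖_p ≥ (2 D M ∏ⱼ max(|num αⱼ|, den αⱼ))^{-4^{k+1}}`   (`norm_evL_ge`).

This is the lower bound needed at the half points of the `2`-descent in the `p`-adic port of the
Cijsouw–Waldschmidt argument (blueprint §3, dictionary row "Liouville at integer & half points").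
Proof: induction on `k` through the conjugate `x̄ = u − sₖ v` of `x = u + sₖ v` (`x̄ ≠ 0` by the
linear independence of the monomials, `PadicMultiquadratic.evL_ne_zero`), the norm
`x x̄ = u² − αₖ v²` (an evaluation over `k` roots, `evL_cmul`), `p`-adic integrality `‖x̄‖_p ≤ D`
(`norm_evL_le_natCast`), and at the bottom `‖z/D‖_p ≥ ‖z‖_p ≥ 1/|z| ≥ 1/(DM)`
(`inv_natCast_le_norm_natCast`); the archimedean sizes (`CW77.l1_cmul_le`, `CW77.exists_int_cmul`)
enter only through the numerator at the bottom. Everything is [folklore]; nothing is claimed in print.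
-/

noncomputable section

open Finset Literature.NumberTheory.Transcendental.CW77

namespace Summit.ABC.StewartYu

namespace Multiquad

open Literature.NumberTheory.Transcendental

variable {p : ℕ} [Fact p.Prime] {k : ℕ}

/-- Integrality: a monomial of `p`-adic integers has norm `≤ 1`. [folklore] -/
theorem norm_monoL_le_one (s : Fin k → ℚ_[p]) (hs1 : ∀ j, ‖s j‖ ≤ 1) (S : Finset (Fin k)) :
    ‖monoL s S‖ ≤ 1 := by
  unfold monoL
  rw [norm_prod]
  exact Finset.prod_le_one (fun j _ => norm_nonneg _) fun j _ => hs1 j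

/-- Integrality: a vector with integer coefficients evaluates to a `p`-adic integer. [folklore] -/
theorem norm_evL_le_one_of_int (s : Fin k → ℚ_[p]) (hs1 : ∀ j, ‖s j‖ ≤ 1)
    {c : Finset (Fin k) → ℚ} (hint : ∀ S, ∃ z : ℤ, c S = z) : ‖evL s c‖ ≤ 1 := by
  unfold evL
  refine IsUltrametricDist.norm_sum_le_of_forall_le_of_nonneg zero_le_one fun S _ => ?_
  obtain ⟨z, hz⟩ := hint S
  rw [norm_mul, hz]
  have h1 : ‖((z : ℚ) : ℚ_[p])‖ ≤ 1 := by
    rw [Rat.cast_intCast]; exact Padic.norm_int_le_one z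
  exact mul_le_one₀ h1 (norm_nonneg _) (norm_monoL_le_one s hs1 S)

/-- `‖D‖_p ≥ 1/D` and hence `1/‖D‖_p ≤ D` for a positive integer `D`. [folklore] -/
theorem inv_norm_natCast_le {D : ℕ} (hD : 1 ≤ D) : 1 / ‖(D : ℚ_[p])‖ ≤ D := by
  have hD0 : D ≠ 0 := by omega
  have h := inv_natCast_le_norm_natCast (p := p) hD0
  have hDpos : (0 : ℝ) < D := by exact_mod_cast Nat.pos_of_ne_zero hD0
  have hnorm : 0 < ‖(D : ℚ_[p])‖ := norm_pos_iff.mpr (Nat.cast_ne_zero.mpr hD0)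
  rw [one_div, inv_le_comm₀ hnorm hDpos]
  exact h

/-- A vector `c` with `D c_S ∈ ℤ` evaluates to a `p`-adic number of norm `≤ D`. [folklore] -/
theorem norm_evL_le_natCast (s : Fin k → ℚ_[p]) (hs1 : ∀ j, ‖s j‖ ≤ 1)
    {c : Finset (Fin k) → ℚ} {D : ℕ} (hD : 1 ≤ D) (hden : ∀ S, ∃ z : ℤ, (D : ℚ) * c S = z) :
    ‖evL s c‖ ≤ D := by
  have hD0 : D ≠ 0 := by omega
  have hint : ∀ S, ∃ z : ℤ, ((D : ℚ) • c) S = z := fun S => by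
    obtain ⟨z, hz⟩ := hden S; exact ⟨z, by simpa using hz⟩
  have h1 := norm_evL_le_one_of_int s hs1 hint
  rw [evL_smul, norm_mul, Rat.cast_natCast] at h1
  have hnorm : 0 < ‖(D : ℚ_[p])‖ := norm_pos_iff.mpr (Nat.cast_ne_zero.mpr hD0)
  have h2 : ‖evL s c‖ ≤ 1 / ‖(D : ℚ_[p])‖ := by
    rw [le_div_iff₀ hnorm]; linarith [h1]
  exact h2.trans (inv_norm_natCast_le hD)

/-- `‖z‖_p ≥ 1/|z|` for a non-zero integer `z`. [folklore] -/
theorem inv_abs_le_norm_intCast {z : ℤ} (hz : z ≠ 0) : 1 / |(z : ℝ)| ≤ ‖(z : ℚ_[p])‖ := by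
  have hn : z.natAbs ≠ 0 := Int.natAbs_ne_zero.mpr hz
  have h := inv_natCast_le_norm_natCast (p := p) hn
  have habs : |(z : ℝ)| = (z.natAbs : ℝ) := by
    rw [← Int.cast_natCast, Int.natCast_natAbs, Int.cast_abs]
  have hnorm : ‖(z : ℚ_[p])‖ = ‖((z.natAbs : ℕ) : ℚ_[p])‖ := by
    rcases Int.natAbs_eq z with h' | h'
    · conv_lhs => rw [h']
      simp
    · conv_lhs => rw [h']
      simp
  rw [habs, hnorm, one_div]
  exact h

/-- The numerical step of the `p`-adic induction. [folklore] -/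
theorem padic_numeric_step {D M H P y x : ℝ} {E : ℕ} (hD : 1 ≤ D) (hM : 1 ≤ M) (hH : 1 ≤ H)
    (hP : 1 ≤ P) (hE : 1 ≤ E)
    (hy : 1 / (4 * D ^ 2 * M ^ 2 * H ^ 2 * P ^ 3) ^ E ≤ y) (hxy : y ≤ x * D) :
    1 / (2 * D * M * (P * H)) ^ (4 * E) ≤ x := by
  set A : ℝ := 4 * D ^ 2 * M ^ 2 * H ^ 2 * P ^ 3 with hA
  have hD2 : 1 ≤ D ^ 2 := one_le_pow₀ hD
  have hM2 : 1 ≤ M ^ 2 := one_le_pow₀ hM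
  have hH2 : 1 ≤ H ^ 2 := one_le_pow₀ hH
  have hP3 : 1 ≤ P ^ 3 := one_le_pow₀ hP
  have hQ1 : 1 ≤ 4 * D ^ 2 * M ^ 2 * H ^ 2 := by
    have := one_le_mul_of_one_le_of_one_le (one_le_mul_of_one_le_of_one_le hD2 hM2) hH2
    linarith
  have hA1 : 1 ≤ A := by rw [hA]; exact one_le_mul_of_one_le_of_one_le hQ1 hP3
  have hAE : 0 < A ^ E := by positivity
  have hD0 : 0 < D := by linarith
  -- `x ≥ 1 / (A^E D)`
  have hx : 1 / (A ^ E * D) ≤ x := by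
    rw [div_le_iff₀ (by positivity)]
    have h1 : 1 / A ^ E ≤ x * D := hy.trans hxy
    calc (1 : ℝ) = 1 / A ^ E * A ^ E := by field_simp
      _ ≤ x * D * A ^ E := mul_le_mul_of_nonneg_right h1 hAE.le
      _ = x * (A ^ E * D) := by ring
  refine le_trans ?_ hx
  -- `A^E D ≤ ((2DMPH)^4)^E`
  set Q : ℝ := 4 * D ^ 2 * M ^ 2 * H ^ 2 * P with hQ
  have hQ1' : 1 ≤ Q := by rw [hQ]; exact one_le_mul_of_one_le_of_one_le hQ1 hP
  have hDQ : D ≤ Q := by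
    have h14 : 1 ≤ 4 * D * M ^ 2 * H ^ 2 * P := by
      have := one_le_mul_of_one_le_of_one_le
        (one_le_mul_of_one_le_of_one_le (one_le_mul_of_one_le_of_one_le hD hM2) hH2) hP
      linarith
    calc D = D * 1 := (mul_one D).symm
      _ ≤ D * (4 * D * M ^ 2 * H ^ 2 * P) := mul_le_mul_of_nonneg_left h14 hD0.le
      _ = Q := by rw [hQ]; ring
  have hDQE : D ≤ Q ^ E := by
    calc D ≤ Q := hDQ
      _ = Q ^ 1 := (pow_one _).symm
      _ ≤ Q ^ E := pow_le_pow_right₀ hQ1' hE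
  have hB : A ^ E * D ≤ (2 * D * M * (P * H)) ^ (4 * E) := by
    calc A ^ E * D ≤ A ^ E * Q ^ E := mul_le_mul_of_nonneg_left hDQE hAE.le
      _ = (A * Q) ^ E := (mul_pow _ _ _).symm
      _ = ((2 * D * M * (P * H)) ^ 4) ^ E := by congr 1; rw [hA, hQ]; ring
      _ = (2 * D * M * (P * H)) ^ (4 * E) := by rw [← pow_mul]
  exact one_div_le_one_div_of_le (by positivity) hB

set_option maxHeartbeats 800000 in
/-- **The `p`-adic Liouville inequality in `ℚ(√α₁, …, √αₖ) ⊂ ℚ_p`.** Let `αⱼ ∈ ℚ` have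
`𝔽₂`-independent square classes (no non-empty sub-product is a square in `ℚ`) and let `sⱼ ∈ ℚ_p` be
`p`-adic integers with `sⱼ² = αⱼ` (e.g. the `p`-adic square roots of principal units). If `c ≠ 0`,
`D c_S ∈ ℤ` for all `S` and `∑ |c_S| ≤ M` (`D, M ≥ 1`), then
`‖∑_S c_S ∏_{j∈S} sⱼ‖_p ≥ (2 D M ∏ⱼ max(|num αⱼ|, den αⱼ))^{-4^{k+1}}`.
Proof: induction on `k` via the conjugate `x̄ = u − s_k v` of `x = u + s_k v`: `x̄ ≠ 0` by the
linear independence of the monomials, `x x̄ = u² − αₖ v²` is an evaluation over `k` roots,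
`‖x̄‖_p ≤ D` (integrality), and at `k = 0` a non-zero rational `z/D` has `‖z/D‖_p ≥ ‖z‖_p ≥ 1/|z|`.
This is the `p`-adic counterpart of `CW77.abs_ev_ge` (Cijsouw–Waldschmidt 1977, Lemma 10 over `ℚ`);
the archimedean sizes enter only through the numerator of the norm at the bottom. [folklore] -/
theorem norm_evL_ge : ∀ (k : ℕ) (α : Fin k → ℚ),
    (∀ T : Finset (Fin k), T.Nonempty → ¬ IsSquare (∏ j ∈ T, α j)) →
    ∀ (s : Fin k → ℚ_[p]), (∀ j, s j * s j = (α j : ℚ_[p])) → (∀ j, ‖s j‖ ≤ 1) →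
    ∀ (c : Finset (Fin k) → ℚ), c ≠ 0 → ∀ (D : ℕ), 1 ≤ D → (∀ S, ∃ z : ℤ, (D : ℚ) * c S = z) →
    ∀ (M : ℝ), 1 ≤ M → ∑ S, |(c S : ℝ)| ≤ M →
    1 / (2 * D * M * heightProd α) ^ (4 ^ (k + 1)) ≤ ‖evL s c‖ := by
  intro k
  induction k with
  | zero =>
    intro α hind s hs hs1 c hc D hD hden M hM hcM
    -- `evL s c = c ∅`, a non-zero rational with denominator `≤ D`
    have huniv : (univ : Finset (Finset (Fin 0))) = {∅} := by
      ext S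
      simp only [Finset.mem_univ, Finset.mem_singleton, true_iff]
      exact Finset.eq_empty_of_isEmpty S
    have hev : evL s c = ((c ∅ : ℚ) : ℚ_[p]) := by
      unfold evL
      rw [huniv, Finset.sum_singleton]
      unfold monoL
      rw [Finset.prod_empty, mul_one]
    have hc0 : c ∅ ≠ 0 := by
      intro h; apply hc; funext S
      have : S = ∅ := Finset.eq_empty_of_isEmpty S
      rw [this, h]; rfl
    obtain ⟨z, hz⟩ := hden ∅
    have hD0 : (D : ℚ) ≠ 0 := by exact_mod_cast (show D ≠ 0 by omega)
    have hz0 : z ≠ 0 := by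
      rintro rfl
      rw [Int.cast_zero, mul_eq_zero] at hz
      rcases hz with h | h
      · exact hD0 h
      · exact hc0 h
    have hcz : c ∅ = (z : ℚ) / D := by
      field_simp; rw [mul_comm]; exact hz
    -- archimedean: `|z| ≤ D M`
    have hcM' : |((c ∅ : ℚ) : ℝ)| ≤ M := by
      have : |((c ∅ : ℚ) : ℝ)| ≤ ∑ S, |(c S : ℝ)| := by
        rw [huniv, Finset.sum_singleton]
      exact this.trans hcM
    have hDR : (0 : ℝ) < D := by exact_mod_cast (show 0 < D by omega)
    have hzle : |(z : ℝ)| ≤ D * M := by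
      have h1 : ((c ∅ : ℚ) : ℝ) = (z : ℝ) / D := by rw [hcz]; push_cast; rfl
      rw [h1, abs_div, abs_of_pos hDR, div_le_iff₀ hDR] at hcM'
      linarith [hcM']
    have hzabs : (0 : ℝ) < |(z : ℝ)| := by
      have : (z : ℝ) ≠ 0 := by exact_mod_cast hz0
      exact abs_pos.mpr this
    -- `p`-adic: `‖c ∅‖ = ‖z‖/‖D‖ ≥ ‖z‖ ≥ 1/|z|`
    have hnormD : ‖(D : ℚ_[p])‖ ≤ 1 := by
      have := Padic.norm_int_le_one (p := p) (D : ℤ)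
      simpa using this
    have hnormD0 : 0 < ‖(D : ℚ_[p])‖ :=
      norm_pos_iff.mpr (Nat.cast_ne_zero.mpr (show D ≠ 0 by omega))
    have hge : ‖((z : ℚ) : ℚ_[p])‖ ≤ ‖evL s c‖ := by
      rw [hev, hcz, Rat.cast_div, Rat.cast_intCast, Rat.cast_natCast, norm_div]
      rw [le_div_iff₀ hnormD0]
      calc ‖((z : ℚ) : ℚ_[p])‖ * ‖(D : ℚ_[p])‖ ≤ ‖((z : ℚ) : ℚ_[p])‖ * 1 :=
            mul_le_mul_of_nonneg_left hnormD (norm_nonneg _)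
        _ = ‖((z : ℤ) : ℚ_[p])‖ := by rw [mul_one, Rat.cast_intCast]
    have hz1 : 1 / |(z : ℝ)| ≤ ‖((z : ℚ) : ℚ_[p])‖ := by
      rw [Rat.cast_intCast]; exact inv_abs_le_norm_intCast hz0
    have hP : heightProd α = 1 := by unfold heightProd; simp
    rw [hP, mul_one]
    have hD1 : (1 : ℝ) ≤ D := by exact_mod_cast hD
    have hDM1 : (1 : ℝ) ≤ D * M := one_le_mul_of_one_le_of_one_le hD1 hM
    have hpow : |(z : ℝ)| ≤ (2 * (D : ℝ) * M) ^ (4 ^ (0 + 1)) := by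
      calc |(z : ℝ)| ≤ D * M := hzle
        _ ≤ 2 * D * M := by nlinarith
        _ = (2 * D * M) ^ 1 := (pow_one _).symm
        _ ≤ (2 * D * M) ^ (4 ^ (0 + 1)) := pow_le_pow_right₀ (by nlinarith) (by norm_num)
    calc 1 / (2 * (D : ℝ) * M) ^ 4 ^ (0 + 1) ≤ 1 / |(z : ℝ)| :=
          one_div_le_one_div_of_le hzabs hpow
      _ ≤ ‖((z : ℚ) : ℚ_[p])‖ := hz1
      _ ≤ ‖evL s c‖ := hge
  | succ k ih =>
    intro α' hind s' hs' hs1' c hc D hD hden M hM hcM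
    set a : ℚ := α' (Fin.last k) with ha
    set α : Fin k → ℚ := init α' with hαdef
    set s : Fin k → ℚ_[p] := initL s' with hsdef
    have hs : ∀ j, s j * s j = (α j : ℚ_[p]) := fun j => hs' _
    have hs1 : ∀ j, ‖s j‖ ≤ 1 := fun j => hs1' _
    have hindα : ∀ T : Finset (Fin k), T.Nonempty → ¬ IsSquare (∏ j ∈ T, α j) := hind_init α' hind
    set H : ℝ := hgt a with hH
    set P : ℝ := heightProd α with hP
    have hH1 : 1 ≤ H := one_le_hgt a
    have hP1 : 1 ≤ P := one_le_heightProd α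
    have hP' : heightProd α' = P * H := by
      rw [hP, hH, ha]; unfold heightProd; rw [Fin.prod_univ_castSucc]
    have hD1 : (1 : ℝ) ≤ D := by exact_mod_cast hD
    set u : ℚ_[p] := evL s (lo c) with hu
    set v : ℚ_[p] := evL s (hi c) with hv
    set r : ℚ_[p] := s' (Fin.last k) with hr
    have hrr : r * r = (a : ℚ_[p]) := hs' (Fin.last k)
    have hx : evL s' c = u + r * v := evL_succ s' c
    -- sums of the parts
    have hsum := sum_abs_succ c
    have hlo_le : ∑ S, |(lo c S : ℝ)| ≤ M := by
      have : 0 ≤ ∑ S, |(hi c S : ℝ)| := Finset.sum_nonneg fun S _ => abs_nonneg _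
      linarith
    have hhi_le : ∑ S, |(hi c S : ℝ)| ≤ M := by
      have : 0 ≤ ∑ S, |(lo c S : ℝ)| := Finset.sum_nonneg fun S _ => abs_nonneg _
      linarith
    have hden_lo : ∀ S, ∃ z : ℤ, (D : ℚ) * lo c S = z := fun S => hden _
    have hden_hi : ∀ S, ∃ z : ℤ, (D : ℚ) * hi c S = z := fun S => hden _
    have hE : 4 ^ (k + 1 + 1) = 4 * 4 ^ (k + 1) := by ring
    rcases eq_or_ne (hi c) 0 with hhi0 | hhi0
    · -- no last root: the induction hypothesis for `lo c`
      have hlo0 : lo c ≠ 0 := (lo_hi_ne_zero hc).resolve_right (fun h => h hhi0)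
      have key := ih α hindα s hs hs1 (lo c) hlo0 D hD hden_lo M hM hlo_le
      have hv0 : v = 0 := by rw [hv, hhi0, evL_zero]
      have hx' : evL s' c = u := by rw [hx, hv0]; ring
      rw [hx']
      refine le_trans ?_ key
      rw [hP']
      have hb1 : (1 : ℝ) ≤ 2 * D * M * P := by
        have := one_le_mul_of_one_le_of_one_le (one_le_mul_of_one_le_of_one_le hD1 hM) hP1
        nlinarith
      have hb : 2 * (D : ℝ) * M * P ≤ 2 * D * M * (P * H) := by
        have : 2 * (D : ℝ) * M * P * 1 ≤ 2 * D * M * P * H :=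
          mul_le_mul_of_nonneg_left hH1 (by positivity)
        linarith
      apply one_div_le_one_div_of_le (by positivity)
      calc (2 * (D : ℝ) * M * P) ^ 4 ^ (k + 1) ≤ (2 * D * M * (P * H)) ^ 4 ^ (k + 1) :=
            pow_le_pow_left₀ (by positivity) hb _
        _ ≤ (2 * D * M * (P * H)) ^ 4 ^ (k + 1 + 1) :=
            pow_le_pow_right₀ (hb1.trans hb) (Nat.pow_le_pow_right (by norm_num) (by omega))
    · -- the conjugate and the norm
      set c'' : Finset (Fin k) → ℚ := cmul α (lo c) (lo c) - a • cmul α (hi c) (hi c) with hc''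
      have hev'' : evL s c'' = u * u - (a : ℚ_[p]) * (v * v) := by
        rw [hc'', evL_sub, evL_smul, evL_cmul α s hs, evL_cmul α s hs]
      have hxbar : evL s' (conjLast c) = u - r * v := evL_conjLast s' c
      have hxbar0 : evL s' (conjLast c) ≠ 0 := evL_ne_zero α' hind s' hs' (conjLast_ne_zero hc)
      have hx0 : evL s' c ≠ 0 := evL_ne_zero α' hind s' hs' hc
      have hnorm : evL s' c * evL s' (conjLast c) = evL s c'' := by
        rw [hx, hxbar, hev'', ← hrr]; ring
      have hc''0 : c'' ≠ 0 := by
        intro h0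
        have : evL s c'' = 0 := by rw [h0, evL_zero]
        rw [← hnorm] at this
        rcases mul_eq_zero.mp this with h | h
        · exact hx0 h
        · exact hxbar0 h
      -- denominators and sizes of `c''` (verbatim from the archimedean file)
      set Dd : ℕ := D * D * ∏ j, (α j).den with hDd
      set D'' : ℕ := Dd * a.den with hD''
      have hden'' : ∀ U, ∃ z : ℤ, (D'' : ℚ) * c'' U = z := by
        intro U
        obtain ⟨z₁, hz₁⟩ := exists_int_cmul α (lo c) (lo c) hden_lo hden_lo U
        obtain ⟨z₂, hz₂⟩ := exists_int_cmul α (hi c) (hi c) hden_hi hden_hi U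
        refine ⟨a.den * z₁ - a.num * z₂, ?_⟩
        rw [hc'', hD'']
        simp only [Pi.sub_apply, Pi.smul_apply, smul_eq_mul]
        push_cast
        rw [← hDd] at hz₁ hz₂
        have ha' : (a.den : ℚ) * a = a.num := by rw [mul_comm]; exact Rat.mul_den_eq_num a
        calc ((Dd : ℚ) * a.den) * (cmul α (lo c) (lo c) U - a * cmul α (hi c) (hi c) U)
            = (a.den : ℚ) * ((Dd : ℚ) * cmul α (lo c) (lo c) U) -
              ((a.den : ℚ) * a) * ((Dd : ℚ) * cmul α (hi c) (hi c) U) := by ring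
          _ = (a.den : ℚ) * z₁ - (a.num : ℚ) * z₂ := by rw [hz₁, hz₂, ha']
      have hD''1 : 1 ≤ D'' := by
        rw [hD'', hDd]
        have h1 : 1 ≤ ∏ j, (α j).den := Finset.one_le_prod' fun j _ => (α j).pos
        have := a.pos
        have : 1 ≤ D * D := Nat.one_le_iff_ne_zero.mpr (by positivity)
        exact Nat.one_le_iff_ne_zero.mpr (by positivity)
      have hD''le : (D'' : ℝ) ≤ D ^ 2 * P * H := by
        rw [hD'', hDd]; push_cast
        have h1 : ((∏ j, ((α j).den : ℝ))) ≤ P := by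
          have := prod_den_le α; push_cast at this; exact this
        have h2 : ((a.den : ℝ)) ≤ H := den_le_hgt a
        calc (D : ℝ) * D * (∏ j, ((α j).den : ℝ)) * a.den ≤ (D : ℝ) * D * P * H :=
            mul_le_mul (mul_le_mul_of_nonneg_left h1 (by positivity)) h2 (by positivity)
              (by positivity)
          _ = (D : ℝ) ^ 2 * P * H := by ring
      set M'' : ℝ := 2 * H * P * M ^ 2 with hM''
      have hPabs : ∏ j, max 1 |(α j : ℝ)| ≤ P := prod_max_one_abs_le α
      have hc''M : ∑ U, |(c'' U : ℝ)| ≤ M'' := by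
        have h1 := l1_cmul_le α (lo c) (lo c)
        have h2 := l1_cmul_le α (hi c) (hi c)
        have hlo2 : (∑ S, |(lo c S : ℝ)|) * ∑ S, |(lo c S : ℝ)| ≤ M ^ 2 := by
          rw [sq]; exact mul_le_mul hlo_le hlo_le (Finset.sum_nonneg fun _ _ => abs_nonneg _)
            (by linarith)
        have hhi2 : (∑ S, |(hi c S : ℝ)|) * ∑ S, |(hi c S : ℝ)| ≤ M ^ 2 := by
          rw [sq]; exact mul_le_mul hhi_le hhi_le (Finset.sum_nonneg fun _ _ => abs_nonneg _)
            (by linarith)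
        have hA : ∑ U, |(cmul α (lo c) (lo c) U : ℝ)| ≤ P * M ^ 2 :=
          h1.trans (mul_le_mul hPabs hlo2 (by positivity) (by positivity))
        have hB : ∑ U, |(cmul α (hi c) (hi c) U : ℝ)| ≤ P * M ^ 2 :=
          h2.trans (mul_le_mul hPabs hhi2 (by positivity) (by positivity))
        have haH : |(a : ℝ)| ≤ H := abs_le_hgt a
        calc ∑ U, |(c'' U : ℝ)|
            ≤ ∑ U, (|(cmul α (lo c) (lo c) U : ℝ)| + |(a : ℝ)| * |(cmul α (hi c) (hi c) U : ℝ)|) := by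
              refine Finset.sum_le_sum fun U _ => ?_
              rw [hc'']
              simp only [Pi.sub_apply, Pi.smul_apply, smul_eq_mul, Rat.cast_sub, Rat.cast_mul]
              calc |(cmul α (lo c) (lo c) U : ℝ) - (a : ℝ) * cmul α (hi c) (hi c) U|
                  ≤ |(cmul α (lo c) (lo c) U : ℝ)| + |(a : ℝ) * cmul α (hi c) (hi c) U| :=
                    abs_sub _ _
                _ = _ := by rw [abs_mul]
          _ = ∑ U, |(cmul α (lo c) (lo c) U : ℝ)| +
                |(a : ℝ)| * ∑ U, |(cmul α (hi c) (hi c) U : ℝ)| := by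
              rw [Finset.sum_add_distrib, Finset.mul_sum]
          _ ≤ P * M ^ 2 + H * (P * M ^ 2) :=
              add_le_add hA (mul_le_mul haH hB (by positivity) (by positivity))
          _ ≤ M'' := by
              have : P * M ^ 2 ≤ H * (P * M ^ 2) := le_mul_of_one_le_left (by positivity) hH1
              rw [hM'']; linarith
      have hM''1 : 1 ≤ M'' := by
        rw [hM'']
        have h1 : 1 ≤ H * P * M ^ 2 :=
          one_le_mul_of_one_le_of_one_le (one_le_mul_of_one_le_of_one_le hH1 hP1) (one_le_pow₀ hM)
        linarith
      -- the induction hypothesis for `c''`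
      have key := ih α hindα s hs hs1 c'' hc''0 D'' hD''1 hden'' M'' hM''1 hc''M
      -- `‖x̄‖_p ≤ D`
      have hden_conj : ∀ S, ∃ z : ℤ, (D : ℚ) * conjLast c S = z := by
        intro S
        obtain ⟨z, hz⟩ := hden S
        unfold conjLast
        split_ifs
        · exact ⟨-z, by rw [mul_neg, hz]; push_cast; ring⟩
        · exact ⟨z, hz⟩
      have hxbar_le : ‖evL s' (conjLast c)‖ ≤ D := norm_evL_le_natCast s' hs1' hD hden_conj
      -- assemble
      have hy : 1 / (4 * (D : ℝ) ^ 2 * M ^ 2 * H ^ 2 * P ^ 3) ^ 4 ^ (k + 1) ≤ ‖evL s c''‖ := by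
        refine le_trans ?_ key
        apply one_div_le_one_div_of_le (by positivity)
        apply pow_le_pow_left₀ (by positivity)
        calc 2 * (D'' : ℝ) * M'' * P ≤ 2 * ((D : ℝ) ^ 2 * P * H) * (2 * H * P * M ^ 2) * P := by
              rw [hM'']
              apply mul_le_mul_of_nonneg_right _ (by positivity)
              apply mul_le_mul_of_nonneg_right _ (by positivity)
              exact mul_le_mul_of_nonneg_left hD''le (by norm_num)
          _ = 4 * (D : ℝ) ^ 2 * M ^ 2 * H ^ 2 * P ^ 3 := by ring
      have hxyz : ‖evL s c''‖ ≤ ‖evL s' c‖ * D := by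
        rw [← hnorm, norm_mul]
        exact mul_le_mul_of_nonneg_left hxbar_le (norm_nonneg _)
      rw [hP', hE]
      exact padic_numeric_step hD1 hM hH1 hP1 (Nat.one_le_pow _ _ (by norm_num)) hy hxyz

end Multiquad

end Summit.ABC.StewartYu

end
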